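import Mathlib
import HarnessLib
import Summits.HubbardSuperconductivity.HubbardSuperconductivity.Theorems.KLProgrammeKLRegimeSplitEdgeFactsComplMemberJets
import Summits.HubbardSuperconductivity.HubbardSuperconductivity.Theorems.KLProgrammeKLRegimeSplitEdgeFactsTransferModulusDeep
import Summits.HubbardSuperconductivity.HubbardSuperconductivity.Theorems.KLProgrammeKLRegimeSplitEdgeFactsSoftCount

/-!
# Route `KLProgramme` — edge facts for the pair masses ACROSS TRANSFERS, XI: the (D2)-DEEP ROW for the COMPLEMENTARY MEMBERS `φ = s_{n,m}` (`m ≥ n+1`):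
# `|Σ_p t_n[φ](Q,p) − Σ_p t_n[φ](0,p)| ≤ C(Λ_n, coeffNorm 1 K, coeffNorm 2 K)·|p_Q|_𝕋²`, UNIFORMLY IN `m`, the `βL²` cancelled

Cell gate-hubbard-kl, seat hubbard-kl-k3c1-p1 (g21; child-1 lineage; technique: composed-map remainder propagation).  Assembles row 16 (transfer modulus as a localisable
double sum), the pointwise bounds `B₁, B₂` of `…ComplMemberJets`, the soft count (row 23) and the localised sums (row 24):
* §4 regions and counts: `T = {w_{Λ_n} ≠ 0 at p, φ ≠ 0 at one of p, p±Q}`, `S = {φ ≠ 0 at p, w_{Λ_n} ≠ 0 at one of p, p±Q}`; `1 ≤ n ⇒ 2Λ_n ≤ 3/80`;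
  **`#T ≤ 3·(15367/2)(2Λ_n)²βL²`, `#S ≤ (15367/2)(2Λ_n)²βL²`** (`FrameOK`, `0 < β ≤ L`, `π/β ≤ 2Λ_n`).
* §5 **`klcd_abs_sum_klTransferWeight_sub_pin_le`** (+ deep condition `(4 + coeffNorm 1 K)·|p_Q|_𝕋 ≤ Λ_n/16`):
  `|Σ_p t_n[s_{n,m}](Q,p) − Σ_p t_n[s_{n,m}](0,p)| ≤ 30734·Λ_n·(3B₁ + 2B₂)` — off `T` (`S`) the first (second) summand of row 16 vanishes, on it the hard line `2/Λ_n`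
  (soft line `4/Λ_n`) times `B₁` (`B₂`); in size `≲ 10⁸(κ′ + v′²)(|p_Q|_𝕋/Λ_n)²`, the geometric rate of (D2)-deep.  What stays E1's for (D2): the naming of the masses,
  the geometric sum over deep scales, the ≤ `m₀` edge scales (free envelope), and (D3′).
* §6 numeric form: for `coeffNorm 2 K ≤ 16` (`IsAdmissibleFrame`) the two pointwise bounds are `≤ 6·10⁵·s²/Λ³`, `≤ 1.4·10⁶·s²/Λ³`, so
  **`klcd_abs_sum_klTransferWeight_sub_pin_le_numeric`**: `|W_n(Q) − W_n(0)| ≤ 1.413764·10¹¹·(|p_Q|_𝕋/Λ_n)²`.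
Everything is proved; no definitions; nothing asserts any slot, stub, K3 or SC. [folklore]
-/

noncomputable section

namespace Summit.HubbardSuperconductivity.HubbardSuperconductivity.Theorems.KLRegimeSplit

set_option linter.dupNamespace false -- summit = problem name (single-conjunct summit), D-0017

open Real Finset Literature.MathematicalPhysics.QuantumLattice Literature.Probability.LatticeModels
open Literature.MathematicalPhysics.QuantumLattice.FermiRG
open Summit.HubbardSuperconductivity.HubbardSuperconductivity.Theorems.KLProgrammeLegKernels
open Summit.HubbardSuperconductivity.HubbardSuperconductivity.Theorems.TwoPointAssembly

section ComplDeep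

variable {L M : ℕ} [NeZero L] (β μ : ℝ) (K : TrigPolyC4v)

/-! ## §4 The two regions are counted by the soft count at scale `2Λ_n` -/

/-- `1 ≤ n` ⟹ `2Λ_n ≤ 3/80` (`Λ_n ≤ Λ_0/4 = 1/128`). [folklore] -/
theorem klcd_two_mul_klScale_le {n : ℕ} (hn : 1 ≤ n) : 2 * klScale klE0 n ≤ 3 / 80 := by
  have h := klcd_klScale_le_quarter (n := 0) (m := n) (by omega)
  have h0 : klScale klE0 0 = 1 / 32 := by simp [klScale, klE0]
  rw [h0] at h
  linarith

/-- **Region counts** (`FrameOK`, `0 < β ≤ L`, `1 ≤ n`, `n + 1 ≤ m`, `π/β ≤ 2Λ_n`): the term-1 region `T` (hard centre, member nonzero at one of `p, p ± Q`) has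
`#T ≤ 3·(15367/2)(2Λ_n)²βL²`, the term-2 region `S` (member nonzero at the centre, hard weight nonzero at one of `p, p ± Q`) has `#S ≤ (15367/2)(2Λ_n)²βL²`. [folklore] -/
theorem klcd_card_regions_le [NeZero M] {R : RenConsts} {U : ℝ} {N : ℕ} (hK : FrameOK R U N μ K) (hβ : 0 < β) (hβL : β ≤ L) {n m : ℕ} (hn : 1 ≤ n)
    (hnm : n + 1 ≤ m) (hΛβ : Real.pi / β ≤ 2 * klScale klE0 n) (Q : TorusSite 2 L) :
    ((((univ : Finset (FreqMomentum L M)).filter fun k =>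
        hubbardCutoffWeightCT L M β μ K (klScale klE0 n) k ≠ 0 ∧
          (softSymbolCompl L M β μ K n m (k.1, k.2 + Q) ≠ 0 ∨ softSymbolCompl L M β μ K n m k ≠ 0 ∨ softSymbolCompl L M β μ K n m (k.1, k.2 - Q) ≠ 0)).card : ℝ) ≤
        3 * (15367 / 2 * (2 * klScale klE0 n) ^ 2 * (β * (L : ℝ) ^ 2))) ∧
      (((univ : Finset (FreqMomentum L M)).filter fun k =>
        softSymbolCompl L M β μ K n m k ≠ 0 ∧
          (hubbardCutoffWeightCT L M β μ K (klScale klE0 n) (k.1, k.2 + Q) ≠ 0 ∨ hubbardCutoffWeightCT L M β μ K (klScale klE0 n) k ≠ 0 ∨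
            hubbardCutoffWeightCT L M β μ K (klScale klE0 n) (k.1, k.2 - Q) ≠ 0)).card : ℝ) ≤
        15367 / 2 * (2 * klScale klE0 n) ^ 2 * (β * (L : ℝ) ^ 2) := by
  have hΛ : 0 < klScale klE0 n := klth_klScale_pos n
  have hc := klsc_card_soft_le_of_frameOK (M := M) μ K hK hβ (by positivity) hΛβ (klcd_two_mul_klScale_le hn) hβL
  have e2 : 2 * klScale klE0 n / 2 = klScale klE0 n := by ring
  simp only [e2] at hc
  -- the soft region at `r = Λ_n²` and its three-point thickening
  set S₀ := (univ : Finset (FreqMomentum L M)).filter fun k => matsubaraFreq β M k.1 ^ 2 + nambuXiCT L μ K k.2 ^ 2 ≤ klScale klE0 n ^ 2 with hS₀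
  have h3 := klsc_card_soft_three_le (M := M) μ K β Q (klScale klE0 n ^ 2)
  have hsoft : ∀ k : FreqMomentum L M, softSymbolCompl L M β μ K n m k ≠ 0 →
      matsubaraFreq β M k.1 ^ 2 + nambuXiCT L μ K k.2 ^ 2 ≤ klScale klE0 n ^ 2 :=
    fun k hk => (klcd_sq_lt_of_soft_ne_zero β μ K hnm k hk).1.le
  constructor
  · have hsub : ((univ : Finset (FreqMomentum L M)).filter fun k =>
        hubbardCutoffWeightCT L M β μ K (klScale klE0 n) k ≠ 0 ∧
          (softSymbolCompl L M β μ K n m (k.1, k.2 + Q) ≠ 0 ∨ softSymbolCompl L M β μ K n m k ≠ 0 ∨ softSymbolCompl L M β μ K n m (k.1, k.2 - Q) ≠ 0)) ⊆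
        (univ : Finset (FreqMomentum L M)).filter fun k =>
          matsubaraFreq β M k.1 ^ 2 + nambuXiCT L μ K (k.2 + Q) ^ 2 ≤ klScale klE0 n ^ 2 ∨
            (matsubaraFreq β M k.1 ^ 2 + nambuXiCT L μ K k.2 ^ 2 ≤ klScale klE0 n ^ 2 ∨
              matsubaraFreq β M k.1 ^ 2 + nambuXiCT L μ K (k.2 - Q) ^ 2 ≤ klScale klE0 n ^ 2) := by
      intro k hk
      rw [mem_filter] at hk ⊢
      obtain ⟨-, -, h | h | h⟩ := hk
      · exact ⟨mem_univ _, Or.inl (hsoft _ h)⟩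
      · exact ⟨mem_univ _, Or.inr (Or.inl (hsoft _ h))⟩
      · exact ⟨mem_univ _, Or.inr (Or.inr (hsoft _ h))⟩
    have h1 := (Finset.card_le_card hsub).trans h3
    have h1' : (((univ : Finset (FreqMomentum L M)).filter fun k =>
        hubbardCutoffWeightCT L M β μ K (klScale klE0 n) k ≠ 0 ∧
          (softSymbolCompl L M β μ K n m (k.1, k.2 + Q) ≠ 0 ∨ softSymbolCompl L M β μ K n m k ≠ 0 ∨
            softSymbolCompl L M β μ K n m (k.1, k.2 - Q) ≠ 0)).card : ℝ) ≤ 3 * (S₀.card : ℝ) := by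
      exact_mod_cast h1
    linarith
  · have hsub : ((univ : Finset (FreqMomentum L M)).filter fun k =>
        softSymbolCompl L M β μ K n m k ≠ 0 ∧
          (hubbardCutoffWeightCT L M β μ K (klScale klE0 n) (k.1, k.2 + Q) ≠ 0 ∨ hubbardCutoffWeightCT L M β μ K (klScale klE0 n) k ≠ 0 ∨
            hubbardCutoffWeightCT L M β μ K (klScale klE0 n) (k.1, k.2 - Q) ≠ 0)) ⊆ S₀ := by
      intro k hk
      rw [mem_filter] at hk
      rw [hS₀, mem_filter]
      exact ⟨mem_univ _, hsoft _ hk.2.1⟩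
    have h1 := Finset.card_le_card hsub
    have h1' : (((univ : Finset (FreqMomentum L M)).filter fun k =>
        softSymbolCompl L M β μ K n m k ≠ 0 ∧
          (hubbardCutoffWeightCT L M β μ K (klScale klE0 n) (k.1, k.2 + Q) ≠ 0 ∨ hubbardCutoffWeightCT L M β μ K (klScale klE0 n) k ≠ 0 ∨
            hubbardCutoffWeightCT L M β μ K (klScale klE0 n) (k.1, k.2 - Q) ≠ 0)).card : ℝ) ≤ (S₀.card : ℝ) := by
      exact_mod_cast h1
    linarith

/-! ## §5 The (D2)-deep row for the complementary members -/

/-- **(D2)-deep for the complementary member `s_{n,m}`, `m ≥ n+1`** (`FrameOK`, `0 < β ≤ L`, `1 ≤ n`, `π/β ≤ 2Λ_n`, deep step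
`(4 + coeffNorm 1 K)·|p_Q|_𝕋 ≤ Λ_n/16`): with `Λ = Λ_n`, `B₁` = the term-1 pointwise bound (`klcd_term1_pointwise`), `B₂` = the term-2 pointwise bound
(`klcd_term2_pointwise`), both `∝ |p_Q|_𝕋²`:
**`|Σ_p t_n[s_{n,m}](Q,p) − Σ_p t_n[s_{n,m}](0,p)| ≤ 30734·Λ_n·(3·B₁ + 2·B₂)`** — uniformly in `m`, `M`, `β`, `L`; in size `≲ 10⁸(κ′ + v′²)·(|p_Q|_𝕋/Λ_n)²`. [folklore] -/
theorem klcd_abs_sum_klTransferWeight_sub_pin_le [NeZero M] {R : RenConsts} {U : ℝ} {N : ℕ} (hK : FrameOK R U N μ K) (hβ : 0 < β) (hβL : β ≤ L)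
    {n m : ℕ} (hn : 1 ≤ n) (hnm : n + 1 ≤ m) (hΛβ : Real.pi / β ≤ 2 * klScale klE0 n) (Q : TorusSite 2 L)
    (hdeep : (4 + K.coeffNorm 1) * klTorusNorm L Q ≤ klScale klE0 n / 16) :
    |∑ p, klTransferWeight L M β μ K n (softSymbolCompl L M β μ K n m) Q p - ∑ p, klTransferWeight L M β μ K n (softSymbolCompl L M β μ K n m) 0 p| ≤
      30734 * klScale klE0 n *
        (3 * ((16 / 3 * (((klScale klE0 n + klScale klE0 n / 16) + klScale klE0 n / 2 / 2) * (4 + K.coeffNorm 2) + (4 + K.coeffNorm 1) ^ 2) /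
                    klScale klE0 n ^ 2 +
                  1408 / 9 * ((klScale klE0 n + klScale klE0 n / 16) + klScale klE0 n / 2 / 2) ^ 2 * (4 + K.coeffNorm 1) ^ 2 / klScale klE0 n ^ 4) *
                klTorusNorm L Q ^ 2 * (2 / (klScale klE0 n / 2)) +
              2 * (8 / 3 * ((4 + K.coeffNorm 1) * klTorusNorm L Q * (2 * (((klScale klE0 n + klScale klE0 n / 16) + klScale klE0 n / 2 / 2))) /
                  klScale klE0 n ^ 2) * ((4 + K.coeffNorm 1) * klTorusNorm L Q * (2 / (klScale klE0 n / 2)) ^ 2)) +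
            1 * (((4 + K.coeffNorm 2) + 2 * (4 + K.coeffNorm 1) ^ 2 * (2 / (klScale klE0 n / 2))) * (2 / (klScale klE0 n / 2)) ^ 2 * klTorusNorm L Q ^ 2)) +
          2 * (((16 / 3 * ((klScale klE0 n + klScale klE0 n / 4 / 2) * (4 + K.coeffNorm 2) + (4 + K.coeffNorm 1) ^ 2) / klScale klE0 n ^ 2 +
                    1408 / 9 * (klScale klE0 n + klScale klE0 n / 4 / 2) ^ 2 * (4 + K.coeffNorm 1) ^ 2 / klScale klE0 n ^ 4) * (2 / (klScale klE0 n / 4)) +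
                  2 * (8 / 3 * ((4 + K.coeffNorm 1) * (2 * (klScale klE0 n + klScale klE0 n / 4 / 2)) / klScale klE0 n ^ 2)) * (4 + K.coeffNorm 1) *
                    (2 / (klScale klE0 n / 4)) ^ 2 +
                ((4 + K.coeffNorm 2) + 2 * (4 + K.coeffNorm 1) ^ 2 * (2 / (klScale klE0 n / 4))) * (2 / (klScale klE0 n / 4)) ^ 2) *
              klTorusNorm L Q ^ 2)) := by
  classical
  set Λ := klScale klE0 n with hΛdef
  set v := 4 + K.coeffNorm 1 with hvdef
  set κ := 4 + K.coeffNorm 2 with hκdef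
  set σ := klTorusNorm L Q with hσdef
  have hΛ : 0 < Λ := klth_klScale_pos n
  have hv : 0 ≤ v := by have := TrigPolyC4v.coeffNorm_nonneg 1 K; simp only [hvdef]; linarith
  have hκ : 0 ≤ κ := by have := TrigPolyC4v.coeffNorm_nonneg 2 K; simp only [hκdef]; linarith
  have hσ : 0 ≤ σ := EngineV8.klband_klTorusNorm_nonneg (L := L) Q
  set φ := softSymbolCompl L M β μ K n m with hφdef
  set w := hubbardCutoffWeightCT L M β μ K Λ with hwdef
  set G := propCT L M β μ K with hGdef
  -- the two pointwise bounds
  set B₁ := (16 / 3 * (((Λ + Λ / 16) + Λ / 2 / 2) * κ + v ^ 2) / Λ ^ 2 + 1408 / 9 * ((Λ + Λ / 16) + Λ / 2 / 2) ^ 2 * v ^ 2 / Λ ^ 4) * σ ^ 2 * (2 / (Λ / 2)) +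
      2 * (8 / 3 * (v * σ * (2 * (((Λ + Λ / 16) + Λ / 2 / 2))) / Λ ^ 2) * (v * σ * (2 / (Λ / 2)) ^ 2)) +
    1 * ((κ + 2 * v ^ 2 * (2 / (Λ / 2))) * (2 / (Λ / 2)) ^ 2 * σ ^ 2) with hB₁
  set B₂ := ((16 / 3 * ((Λ + Λ / 4 / 2) * κ + v ^ 2) / Λ ^ 2 + 1408 / 9 * (Λ + Λ / 4 / 2) ^ 2 * v ^ 2 / Λ ^ 4) * (2 / (Λ / 4)) +
        2 * (8 / 3 * (v * (2 * (Λ + Λ / 4 / 2)) / Λ ^ 2)) * v * (2 / (Λ / 4)) ^ 2 + (κ + 2 * v ^ 2 * (2 / (Λ / 4))) * (2 / (Λ / 4)) ^ 2) * σ ^ 2 with hB₂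
  have hB₁0 : 0 ≤ B₁ := by positivity
  have hB₂0 : 0 ≤ B₂ := by positivity
  -- regions
  set T := (univ : Finset (FreqMomentum L M)).filter fun k => w k ≠ 0 ∧ (φ (k.1, k.2 + Q) ≠ 0 ∨ φ k ≠ 0 ∨ φ (k.1, k.2 - Q) ≠ 0) with hT
  set S := (univ : Finset (FreqMomentum L M)).filter fun k => φ k ≠ 0 ∧ (w (k.1, k.2 + Q) ≠ 0 ∨ w k ≠ 0 ∨ w (k.1, k.2 - Q) ≠ 0) with hS
  obtain ⟨hTc, hSc⟩ := klcd_card_regions_le (M := M) β μ K hK hβ hβL hn hnm hΛβ Q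
  -- the two localised summands
  set P₁ : FreqMomentum L M → ℝ := fun k =>
    ‖(w k : ℂ) * G k‖ * ‖(φ (k.1, k.2 + Q) : ℂ) * G (k.1, k.2 + Q) - 2 * ((φ (k.1, k.2) : ℂ) * G (k.1, k.2)) + (φ (k.1, k.2 - Q) : ℂ) * G (k.1, k.2 - Q)‖ with hP₁
  set P₂ : FreqMomentum L M → ℝ := fun k =>
    ‖(φ k : ℂ) * G k‖ * ‖(w (k.1, k.2 + Q) : ℂ) * G (k.1, k.2 + Q) - 2 * ((w (k.1, k.2) : ℂ) * G (k.1, k.2)) + (w (k.1, k.2 - Q) : ℂ) * G (k.1, k.2 - Q)‖ with hP₂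
  have h1 : ∑ k, P₁ k ≤ T.card * (2 / Λ * B₁) := by
    refine klta_sum_le_card_mul P₁ T (2 / Λ * B₁) (fun k hk => ?_) (fun k hk => ?_)
    · rw [hT, mem_filter, not_and_or] at hk
      rcases hk with hk | hk
      · exact absurd (mem_univ k) hk
      rw [not_and_or, not_ne_iff] at hk
      rcases hk with hk | hk
      · simp only [hP₁, hk, Complex.ofReal_zero, zero_mul, norm_zero]
      · push Not at hk
        obtain ⟨a, b, c⟩ := hk
        have b' : φ (k.1, k.2) = 0 := b
        simp only [hP₁, a, b', c, Complex.ofReal_zero, zero_mul, mul_zero, sub_zero, add_zero, norm_zero]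
    · rw [hT, mem_filter] at hk
      obtain ⟨-, hwk, hφ3⟩ := hk
      obtain ⟨ν, p⟩ := k
      have hpt := klcd_term1_pointwise β μ K hβ hnm Q hdeep ν p hwk hφ3
      have hw0 : 0 ≤ w (ν, p) := (salmhoferCutoff_mem_Icc _).1
      have hhard : ‖(w (ν, p) : ℂ) * G (ν, p)‖ ≤ 2 / Λ := by
        rw [klta_norm_ofReal_mul, abs_of_nonneg hw0]
        exact hubbardCutoffWeightCT_mul_norm_propCT_le β μ K hΛ (ν, p)
      simp only [hP₁]
      exact mul_le_mul hhard hpt (norm_nonneg _) (by positivity)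
  have h2 : ∑ k, P₂ k ≤ S.card * (1 / (Λ / 4) * B₂) := by
    refine klta_sum_le_card_mul P₂ S (1 / (Λ / 4) * B₂) (fun k hk => ?_) (fun k hk => ?_)
    · rw [hS, mem_filter, not_and_or] at hk
      rcases hk with hk | hk
      · exact absurd (mem_univ k) hk
      rw [not_and_or, not_ne_iff] at hk
      rcases hk with hk | hk
      · simp only [hP₂, hk, Complex.ofReal_zero, zero_mul, norm_zero]
      · push Not at hk
        obtain ⟨a, b, c⟩ := hk
        have b' : w (k.1, k.2) = 0 := b
        simp only [hP₂, a, b', c, Complex.ofReal_zero, zero_mul, mul_zero, sub_zero, add_zero, norm_zero]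
    · rw [hS, mem_filter] at hk
      obtain ⟨-, hφk, hw3⟩ := hk
      obtain ⟨ν, p⟩ := k
      obtain ⟨hsoftline, hpt⟩ := klcd_term2_pointwise β μ K hβ hnm Q hdeep ν p hφk hw3
      simp only [hP₂]
      rw [klta_norm_ofReal_mul]
      exact mul_le_mul hsoftline hpt (norm_nonneg _) (by positivity)
  -- row 16 and the split
  obtain ⟨hev, hev'⟩ := klcd_soft_even (L := L) (M := M) β μ K n m
  have hmain := abs_sum_klTransferWeight_sub_pin_le β μ K hβ.le n hev hev' Q
  have hsplit : ∑ ν : MatsubaraIdx M, ∑ p : TorusSite 2 L,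
      (‖(w (ν, p) : ℂ) * G (ν, p)‖ * ‖(φ (ν, p + Q) : ℂ) * G (ν, p + Q) - 2 * ((φ (ν, p) : ℂ) * G (ν, p)) + (φ (ν, p - Q) : ℂ) * G (ν, p - Q)‖ +
        ‖(φ (ν, p) : ℂ) * G (ν, p)‖ * ‖(w (ν, p + Q) : ℂ) * G (ν, p + Q) - 2 * ((w (ν, p) : ℂ) * G (ν, p)) + (w (ν, p - Q) : ℂ) * G (ν, p - Q)‖) =
      ∑ k, P₁ k + ∑ k, P₂ k := by
    rw [← sum_add_distrib, klta_sum_sum_eq_sum_prod]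
  have hc : 0 ≤ 1 / 2 * (β * (L : ℝ) ^ 2)⁻¹ := by positivity
  have hL : (1 : ℝ) ≤ L := by exact_mod_cast Nat.one_le_iff_ne_zero.2 (NeZero.ne L)
  have hβL2 : 0 < β * (L : ℝ) ^ 2 := by positivity
  refine hmain.trans ?_
  rw [hsplit]
  -- numeric assembly: `#T ≤ 3N`, `#S ≤ N`, `N = (15367/2)(2Λ)²βL²`
  have e1 : (T.card : ℝ) * (2 / Λ * B₁) ≤ 3 * (15367 / 2 * (2 * Λ) ^ 2 * (β * (L : ℝ) ^ 2)) * (2 / Λ * B₁) :=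
    mul_le_mul_of_nonneg_right hTc (by positivity)
  have e2 : (S.card : ℝ) * (1 / (Λ / 4) * B₂) ≤ 15367 / 2 * (2 * Λ) ^ 2 * (β * (L : ℝ) ^ 2) * (1 / (Λ / 4) * B₂) :=
    mul_le_mul_of_nonneg_right hSc (by positivity)
  have hid : 1 / 2 * (β * (L : ℝ) ^ 2)⁻¹ *
      (3 * (15367 / 2 * (2 * Λ) ^ 2 * (β * (L : ℝ) ^ 2)) * (2 / Λ * B₁) + 15367 / 2 * (2 * Λ) ^ 2 * (β * (L : ℝ) ^ 2) * (1 / (Λ / 4) * B₂)) =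
      30734 * Λ * (3 * B₁ + 2 * B₂) := by
    field_simp
    ring
  calc 1 / 2 * (β * (L : ℝ) ^ 2)⁻¹ * (∑ k, P₁ k + ∑ k, P₂ k)
      ≤ 1 / 2 * (β * (L : ℝ) ^ 2)⁻¹ *
          (3 * (15367 / 2 * (2 * Λ) ^ 2 * (β * (L : ℝ) ^ 2)) * (2 / Λ * B₁) + 15367 / 2 * (2 * Λ) ^ 2 * (β * (L : ℝ) ^ 2) * (1 / (Λ / 4) * B₂)) :=
        mul_le_mul_of_nonneg_left (by linarith) hc
    _ = 30734 * Λ * (3 * B₁ + 2 * B₂) := hid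

/-! ## §6 Numeric form on an admissible frame (`coeffNorm 2 K ≤ 16`) -/

/-- The term-1 pointwise bound is `≤ 6·10⁵·s²/Λ³` for `v, κ ≤ 20`, `0 < Λ ≤ 3/80`. [folklore] -/
theorem klcd_term1_bound_le_numeric {v κ Λ σ : ℝ} (hv0 : 0 ≤ v) (hv : v ≤ 20) (hκ0 : 0 ≤ κ) (hκ : κ ≤ 20) (hΛ : 0 < Λ) (hΛ' : Λ ≤ 3 / 80) :
    (16 / 3 * (((Λ + Λ / 16) + Λ / 2 / 2) * κ + v ^ 2) / Λ ^ 2 + 1408 / 9 * ((Λ + Λ / 16) + Λ / 2 / 2) ^ 2 * v ^ 2 / Λ ^ 4) * σ ^ 2 * (2 / (Λ / 2)) +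
          2 * (8 / 3 * (v * σ * (2 * (((Λ + Λ / 16) + Λ / 2 / 2))) / Λ ^ 2) * (v * σ * (2 / (Λ / 2)) ^ 2)) +
        1 * ((κ + 2 * v ^ 2 * (2 / (Λ / 2))) * (2 / (Λ / 2)) ^ 2 * σ ^ 2) ≤ 600000 * σ ^ 2 / Λ ^ 3 := by
  have hΛ3 : 0 < Λ ^ 3 := by positivity
  rw [le_div_iff₀ hΛ3]
  have key : ((16 / 3 * (((Λ + Λ / 16) + Λ / 2 / 2) * κ + v ^ 2) / Λ ^ 2 + 1408 / 9 * ((Λ + Λ / 16) + Λ / 2 / 2) ^ 2 * v ^ 2 / Λ ^ 4) * σ ^ 2 * (2 / (Λ / 2)) +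
          2 * (8 / 3 * (v * σ * (2 * (((Λ + Λ / 16) + Λ / 2 / 2))) / Λ ^ 2) * (v * σ * (2 / (Λ / 2)) ^ 2)) +
        1 * ((κ + 2 * v ^ 2 * (2 / (Λ / 2))) * (2 / (Λ / 2)) ^ 2 * σ ^ 2)) * Λ ^ 3 =
      (4 * (16 / 3 * ((21 / 16) * Λ * κ + v ^ 2) + 1408 / 9 * (21 / 16) ^ 2 * v ^ 2) + 224 * v ^ 2 + (κ * Λ + 8 * v ^ 2) * 16) * σ ^ 2 := by
    field_simp
    ring
  rw [key]
  have hσ : 0 ≤ σ ^ 2 := sq_nonneg σ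
  have hP : 4 * (16 / 3 * ((21 / 16) * Λ * κ + v ^ 2) + 1408 / 9 * (21 / 16) ^ 2 * v ^ 2) + 224 * v ^ 2 + (κ * Λ + 8 * v ^ 2) * 16 ≤ 600000 := by
    have hv2 : v ^ 2 ≤ 400 := by nlinarith
    have hΛκ : Λ * κ ≤ 3 / 80 * 20 := mul_le_mul hΛ' hκ hκ0 (by norm_num)
    nlinarith
  nlinarith

/-- The term-2 pointwise bound is `≤ 1.4·10⁶·s²/Λ³` for `v, κ ≤ 20`, `0 < Λ ≤ 3/80`. [folklore] -/
theorem klcd_term2_bound_le_numeric {v κ Λ σ : ℝ} (hv0 : 0 ≤ v) (hv : v ≤ 20) (hκ0 : 0 ≤ κ) (hκ : κ ≤ 20) (hΛ : 0 < Λ) (hΛ' : Λ ≤ 3 / 80) :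
    ((16 / 3 * ((Λ + Λ / 4 / 2) * κ + v ^ 2) / Λ ^ 2 + 1408 / 9 * (Λ + Λ / 4 / 2) ^ 2 * v ^ 2 / Λ ^ 4) * (2 / (Λ / 4)) +
          2 * (8 / 3 * (v * (2 * (Λ + Λ / 4 / 2)) / Λ ^ 2)) * v * (2 / (Λ / 4)) ^ 2 + (κ + 2 * v ^ 2 * (2 / (Λ / 4))) * (2 / (Λ / 4)) ^ 2) * σ ^ 2 ≤
      1400000 * σ ^ 2 / Λ ^ 3 := by
  have hΛ3 : 0 < Λ ^ 3 := by positivity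
  rw [le_div_iff₀ hΛ3]
  have key : ((16 / 3 * ((Λ + Λ / 4 / 2) * κ + v ^ 2) / Λ ^ 2 + 1408 / 9 * (Λ + Λ / 4 / 2) ^ 2 * v ^ 2 / Λ ^ 4) * (2 / (Λ / 4)) +
          2 * (8 / 3 * (v * (2 * (Λ + Λ / 4 / 2)) / Λ ^ 2)) * v * (2 / (Λ / 4)) ^ 2 + (κ + 2 * v ^ 2 * (2 / (Λ / 4))) * (2 / (Λ / 4)) ^ 2) * σ ^ 2 * Λ ^ 3 =
      (8 * (16 / 3 * ((9 / 8) * Λ * κ + v ^ 2) + 1408 / 9 * (9 / 8) ^ 2 * v ^ 2) + 768 * v ^ 2 + (κ * Λ + 16 * v ^ 2) * 64) * σ ^ 2 := by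
    field_simp
    ring
  rw [key]
  have hσ : 0 ≤ σ ^ 2 := sq_nonneg σ
  have hP : 8 * (16 / 3 * ((9 / 8) * Λ * κ + v ^ 2) + 1408 / 9 * (9 / 8) ^ 2 * v ^ 2) + 768 * v ^ 2 + (κ * Λ + 16 * v ^ 2) * 64 ≤ 1400000 := by
    have hv2 : v ^ 2 ≤ 400 := by nlinarith
    have hΛκ : Λ * κ ≤ 3 / 80 * 20 := mul_le_mul hΛ' hκ hκ0 (by norm_num)
    nlinarith
  nlinarith

/-- **(D2)-deep, numeric form on an admissible frame**: `FrameOK`, `IsAdmissibleFrame K` (`coeffNorm 2 K ≤ 16`), `0 < β ≤ L`, `1 ≤ n`, `n + 1 ≤ m`, `π/β ≤ 2Λ_n`, deep step ⟹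
**`|Σ_p t_n[s_{n,m}](Q,p) − Σ_p t_n[s_{n,m}](0,p)| ≤ 1.413764·10¹¹·(|p_Q|_𝕋/Λ_n)²`** (`30734·(3·6·10⁵ + 2·1.4·10⁶)`). [folklore] -/
theorem klcd_abs_sum_klTransferWeight_sub_pin_le_numeric [NeZero M] {R : RenConsts} {U : ℝ} {N : ℕ} (hK : FrameOK R U N μ K) (hKa : IsAdmissibleFrame K)
    (hβ : 0 < β) (hβL : β ≤ L) {n m : ℕ} (hn : 1 ≤ n) (hnm : n + 1 ≤ m) (hΛβ : Real.pi / β ≤ 2 * klScale klE0 n) (Q : TorusSite 2 L)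
    (hdeep : (4 + K.coeffNorm 1) * klTorusNorm L Q ≤ klScale klE0 n / 16) :
    |∑ p, klTransferWeight L M β μ K n (softSymbolCompl L M β μ K n m) Q p - ∑ p, klTransferWeight L M β μ K n (softSymbolCompl L M β μ K n m) 0 p| ≤
      141376400000 * (klTorusNorm L Q / klScale klE0 n) ^ 2 := by
  have h := klcd_abs_sum_klTransferWeight_sub_pin_le (M := M) β μ K hK hβ hβL hn hnm hΛβ Q hdeep
  have hΛ : 0 < klScale klE0 n := klth_klScale_pos n
  have hΛ' : klScale klE0 n ≤ 3 / 80 := (klScale_klE0_lt_tube n).le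
  have hκ2 : K.coeffNorm 2 ≤ 16 := (isAdmissibleFrame_iff K).1 hKa
  have hκ1 : K.coeffNorm 1 ≤ 16 := (TrigPolyC4v.coeffNorm_mono (by norm_num) K).trans hκ2
  have hv0 : 0 ≤ 4 + K.coeffNorm 1 := by have := TrigPolyC4v.coeffNorm_nonneg 1 K; linarith
  have hκ0 : 0 ≤ 4 + K.coeffNorm 2 := by have := TrigPolyC4v.coeffNorm_nonneg 2 K; linarith
  have h1 := klcd_term1_bound_le_numeric (σ := klTorusNorm L Q) hv0 (by linarith) hκ0 (by linarith) hΛ hΛ'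
  have h2 := klcd_term2_bound_le_numeric (σ := klTorusNorm L Q) hv0 (by linarith) hκ0 (by linarith) hΛ hΛ'
  refine h.trans ?_
  have hid : 141376400000 * (klTorusNorm L Q / klScale klE0 n) ^ 2 =
      30734 * klScale klE0 n * (3 * (600000 * klTorusNorm L Q ^ 2 / klScale klE0 n ^ 3) + 2 * (1400000 * klTorusNorm L Q ^ 2 / klScale klE0 n ^ 3)) := by
    field_simp
    ring
  rw [hid]
  exact mul_le_mul_of_nonneg_left (by linarith) (by positivity)

end ComplDeep

end Summit.HubbardSuperconductivity.HubbardSuperconductivity.Theorems.KLRegimeSplit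

end
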